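import Summits.SmoothPoincare4.SmoothPoincare4.Theorems.EntropyRungNoncompactShrinkerGapHeatDissipationCutoff
import Summits.SmoothPoincare4.SmoothPoincare4.Theorems.EntropyRungNoncompactShrinkerGapHeatMaxPrincipleAux

/-!
# The Bakry–Émery entropy dissipation `H(0) − H(T) ≤ I(0)/2K` along the weighted heat flow on a complete manifold
# (crux `EntropyRung.NoncompactShrinkerGap`, stmt-SmoothPoincare4-10868, line `collapsed-ends-usc`, v13)

Registered helper `helper_entropyDissipation` of the stub `stub_compactSupportLSI`. Setting: `(M, g)` modelled on `ℝⁿ`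
(NOT compact), `Ric + Hess V ≥ K g`, `K > 0`, `∫ e^{-V} < ∞`, cut-offs `η_k` (smooth, compactly supported, `0 ≤ η_k ≤ 1`,
eventually `= 1` near every point, `|Lη_k| ≤ C`), and a solution `ρ` of `∂ₜρ = Lρ` on `[0,T]` with `c ≤ ρ ≤ C'`,
`|∇ρ|² ≤ G`. Then, with `H(t) = ∫ ρ log ρ e^{-V}` and `I(0) = ∫ |∇ρ₀|²/ρ₀ e^{-V}`,

  `H(0) − H(T) ≤ I(0)/(2K)`.

Proof: the one-cut-off inequality `cutoffEntropy_le` for `η = η_k`,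
`B_k(0) − B_k(T) ≤ A_k(0)/2K + T (C'Λ + G/2Kc) ∫|Lη_k|e^{-V}`, and `k → ∞` by dominated convergence: the cut-off entropies
and Fisher informations converge to `H(0)`, `H(T)`, `I(0)` (integrands bounded by multiples of `e^{-V}`, `η_k → 1`), and
`∫ |Lη_k| e^{-V} → 0` (`|Lη_k| ≤ C`, `Lη_k → 0` pointwise since `η_k` is eventually `1` near every point). This is the
non-compact replacement of `entropy_le_fisher_div` (`BakryEmeryHeatFlow.lean`); the limit `T → ∞` is taken by the caller.
Everything is proved; no definitions.
-/

noncomputable section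

set_option linter.dupNamespace false

open scoped Manifold ContDiff ENNReal NNReal Topology
open MeasureTheory Set Filter
open Literature.Geometry.Lorentzian Literature.Geometry.Riemannian

namespace Summit.SmoothPoincare4.SmoothPoincare4.Theorems.NoncompactShrinkerGapHeat

section Limit

variable {n : ℕ} {M : Type*} [TopologicalSpace M] [T2Space M] [SecondCountableTopology M]
  [ChartedSpace (EuclideanSpace ℝ (Fin n)) M] [IsManifold (𝓡 n) ∞ M] [T3Space M] [MeasurableSpace M]
  [BorelSpace M]
  {g : PseudoRiemannianMetric (𝓡 n) ∞ (EuclideanSpace ℝ (Fin n)) (TangentSpace (𝓡 n) : M → Type _)}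
  [g.HasLeviCivita]

omit [T2Space M] [SecondCountableTopology M] [g.HasLeviCivita] in
/-- **Dominated convergence against the cut-offs**: if `|F| ≤ B e^{-V}` with `e^{-V}` integrable, `F` continuous,
and `0 ≤ η_k ≤ 1` continuous with `η_k → 1` pointwise, then `∫ η_k F → ∫ F`. [folklore] -/
theorem tendsto_integral_cutoff_mul {V : M → ℝ} (hfin : Integrable (fun x ↦ Real.exp (-V x)) g.riemVolume)
    {η : ℕ → M → ℝ} (hηcont : ∀ k, Continuous (η k)) (hη01 : ∀ k x, 0 ≤ η k x ∧ η k x ≤ 1)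
    (hηlim : ∀ x, Tendsto (fun k ↦ η k x) atTop (𝓝 1))
    {F : M → ℝ} (hF : Continuous F) {B : ℝ} (hB : ∀ x, |F x| ≤ B * Real.exp (-V x)) :
    Tendsto (fun k ↦ ∫ x, η k x * F x ∂g.riemVolume) atTop (𝓝 (∫ x, F x ∂g.riemVolume)) := by
  refine tendsto_integral_of_dominated_convergence (fun x ↦ B * Real.exp (-V x))
    (fun k ↦ ((hηcont k).mul hF).aestronglyMeasurable) (hfin.const_mul B) (fun k ↦ ?_) ?_
  · refine Eventually.of_forall fun x ↦ ?_
    rw [Real.norm_eq_abs, abs_mul, abs_of_nonneg (hη01 k x).1]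
    calc η k x * |F x| ≤ 1 * |F x| := mul_le_mul_of_nonneg_right (hη01 k x).2 (abs_nonneg _)
      _ ≤ B * Real.exp (-V x) := by rw [one_mul]; exact hB x
  · refine Eventually.of_forall fun x ↦ ?_
    simpa using (hηlim x).mul_const (F x)

/-- **The Bakry–Émery entropy dissipation along the weighted heat flow on a (non-compact) manifold**
(see the module docstring): `H(0) − H(T) ≤ I(0)/(2K)`. [cite: CarrilloNi2009, §3 (3.2)–(3.4) and p. 8] -/
theorem entropyDissipation_le (hg : g.IsRiemannian) {V : M → ℝ} {K : ℝ} (hV : ContMDiff (𝓡 n) 𝓘(ℝ, ℝ) ∞ V)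
    (hK : 0 < K)
    (hRic : ∀ (y : M) (X : TangentSpace (𝓡 n) y), K * g.val y X X ≤ g.ricci y X X + g.hessian V y X X)
    (hfin : Integrable (fun x ↦ Real.exp (-V x)) g.riemVolume)
    {η : ℕ → M → ℝ} {C : ℝ} (hηs : ∀ k, ContMDiff (𝓡 n) 𝓘(ℝ, ℝ) ∞ (η k)) (hηc : ∀ k, HasCompactSupport (η k))
    (hη01 : ∀ k x, 0 ≤ η k x ∧ η k x ≤ 1) (hη1 : ∀ x, ∀ᶠ k in atTop, ∀ᶠ y in 𝓝 x, η k y = 1)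
    (hηL : ∀ k x, |g.dalembertian (η k) x - g.innerDual x (mvfderiv (𝓡 n) V x).toLinearMap
      (mvfderiv (𝓡 n) (η k) x).toLinearMap| ≤ C)
    {T : ℝ} {O : Set ℝ} {ρ : ℝ → M → ℝ} (hT : 0 < T) (hO : IsOpen O) (hTO : Icc 0 T ⊆ O)
    (hρ : ContMDiffOn ((𝓡 n).prod 𝓘(ℝ, ℝ)) 𝓘(ℝ, ℝ) ∞ (fun p : M × ℝ ↦ ρ p.2 p.1) (univ ×ˢ O))
    (heq : ∀ s ∈ Icc 0 T, ∀ x, deriv (fun r ↦ ρ r x) s = g.dalembertian (ρ s) x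
      - g.innerDual x (mvfderiv (𝓡 n) V x).toLinearMap (mvfderiv (𝓡 n) (ρ s) x).toLinearMap)
    {c C' G : ℝ} (hc : 0 < c) (hbd : ∀ s ∈ Icc 0 T, ∀ x, c ≤ ρ s x ∧ ρ s x ≤ C')
    (hgrad : ∀ s ∈ Icc 0 T, ∀ x, g.gradSq (ρ s) x ≤ G) :
    (∫ x, ρ 0 x * Real.log (ρ 0 x) * Real.exp (-V x) ∂g.riemVolume)
      - (∫ x, ρ T x * Real.log (ρ T x) * Real.exp (-V x) ∂g.riemVolume) ≤
      1 / (2 * K) * ∫ x, g.gradSq (ρ 0) x / ρ 0 x * Real.exp (-V x) ∂g.riemVolume := by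
  have h0S : (0 : ℝ) ∈ Icc 0 T := ⟨le_rfl, hT.le⟩
  have hTS : T ∈ Icc 0 T := ⟨hT.le, le_rfl⟩
  -- the one-cut-off inequalities
  have hk : ∀ k, (∫ y, η k y * (ρ 0 y * Real.log (ρ 0 y) * Real.exp (-V y)) ∂g.riemVolume)
      - (∫ y, η k y * (ρ T y * Real.log (ρ T y) * Real.exp (-V y)) ∂g.riemVolume) ≤
      1 / (2 * K) * ∫ y, η k y * (g.gradSq (ρ 0) y / ρ 0 y * Real.exp (-V y)) ∂g.riemVolume
      + T * ((C' * max |Real.log c| |Real.log C'| + G / c / (2 * K)) *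
          ∫ y, |g.dalembertian (η k) y - g.innerDual y (mvfderiv (𝓡 n) V y).toLinearMap
            (mvfderiv (𝓡 n) (η k) y).toLinearMap| * Real.exp (-V y) ∂g.riemVolume) := fun k ↦
    cutoffEntropy_le hg hV hK hRic hT hO hTO hρ heq hc hbd hgrad (hηs k) (hηc k) (fun y ↦ (hη01 k y).1)
  -- pointwise limits of the cut-offs
  have hηcont : ∀ k, Continuous (η k) := fun k ↦ (hηs k).continuous
  have hηlim : ∀ x, Tendsto (fun k ↦ η k x) atTop (𝓝 1) := fun x ↦ by
    refine tendsto_const_nhds.congr' ?_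
    filter_upwards [hη1 x] with k hk
    exact (hk.self_of_nhds).symm
  have hLlim : ∀ x, Tendsto (fun k ↦ |g.dalembertian (η k) x - g.innerDual x (mvfderiv (𝓡 n) V x).toLinearMap
      (mvfderiv (𝓡 n) (η k) x).toLinearMap| * Real.exp (-V x)) atTop (𝓝 0) := fun x ↦ by
    refine tendsto_const_nhds.congr' ?_
    filter_upwards [hη1 x] with k hk
    rw [weightedLaplacian_eq_zero_of_eventuallyEq_one (hηs k) hk, abs_zero, zero_mul]
  -- continuity of the slices at `0` and `T`
  have hslice : ∀ t ∈ Icc 0 T, ContMDiff (𝓡 n) 𝓘(ℝ, ℝ) ∞ (ρ t) := fun t ht ↦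
    hρ.comp_contMDiff (contMDiff_id.prodMk contMDiff_const) fun y ↦ ⟨mem_univ _, hTO ht⟩
  have hWc : Continuous fun y ↦ Real.exp (-V y) := Real.continuous_exp.comp hV.continuous.neg
  have hpos : ∀ t ∈ Icc 0 T, ∀ y, 0 < ρ t y := fun t ht y ↦ hc.trans_le (hbd t ht y).1
  have hEc : ∀ t ∈ Icc 0 T, Continuous fun y ↦ ρ t y * Real.log (ρ t y) * Real.exp (-V y) := fun t ht ↦
    ((hslice t ht).continuous.mul ((hslice t ht).continuous.log fun y ↦ (hpos t ht y).ne')).mul hWc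
  have hEbd : ∀ t ∈ Icc 0 T, ∀ y, |ρ t y * Real.log (ρ t y) * Real.exp (-V y)| ≤
      C' * max |Real.log c| |Real.log C'| * Real.exp (-V y) := by
    intro t ht y
    rw [abs_mul, abs_of_nonneg (Real.exp_pos _).le]
    exact mul_le_mul_of_nonneg_right (abs_mul_log_le hc (hbd t ht y).1 (hbd t ht y).2) (Real.exp_pos _).le
  have hIc : Continuous fun y ↦ g.gradSq (ρ 0) y / ρ 0 y * Real.exp (-V y) :=
    ((contMDiff_gradSq g (hslice 0 h0S)).continuous.div (hslice 0 h0S).continuous fun y ↦ (hpos 0 h0S y).ne').mul hWc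
  have hIbd : ∀ y, |g.gradSq (ρ 0) y / ρ 0 y * Real.exp (-V y)| ≤ G / c * Real.exp (-V y) := by
    intro y
    have hQ0 : 0 ≤ g.gradSq (ρ 0) y := g.gradSq_nonneg hg _ _
    have hρ0 := hpos 0 h0S y
    rw [abs_mul, abs_of_nonneg (Real.exp_pos _).le, abs_of_nonneg (div_nonneg hQ0 hρ0.le)]
    refine mul_le_mul_of_nonneg_right ?_ (Real.exp_pos _).le
    rw [div_le_div_iff₀ hρ0 hc]
    nlinarith [hgrad 0 h0S y, (hbd 0 h0S y).1]
  -- the four limits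
  have L1 := tendsto_integral_cutoff_mul (g := g) hfin hηcont hη01 hηlim (hEc 0 h0S) (hEbd 0 h0S)
  have L2 := tendsto_integral_cutoff_mul (g := g) hfin hηcont hη01 hηlim (hEc T hTS) (hEbd T hTS)
  have L3 := tendsto_integral_cutoff_mul (g := g) hfin hηcont hη01 hηlim hIc hIbd
  have L4 : Tendsto (fun k ↦ ∫ y, |g.dalembertian (η k) y - g.innerDual y (mvfderiv (𝓡 n) V y).toLinearMap
      (mvfderiv (𝓡 n) (η k) y).toLinearMap| * Real.exp (-V y) ∂g.riemVolume) atTop (𝓝 0) := by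
    have hV1 : ContMDiff (𝓡 n) 𝓘(ℝ, ℝ) 1 V := hV.of_le (by norm_num)
    have hmeas : ∀ k, AEStronglyMeasurable (fun y ↦ |g.dalembertian (η k) y - g.innerDual y
        (mvfderiv (𝓡 n) V y).toLinearMap (mvfderiv (𝓡 n) (η k) y).toLinearMap| * Real.exp (-V y)) g.riemVolume := by
      intro k
      have h2 : ContMDiff (𝓡 n) 𝓘(ℝ, ℝ) 2 (η k) := (hηs k).of_le (WithTop.coe_le_coe.mpr le_top)
      have h1 : ContMDiff (𝓡 n) 𝓘(ℝ, ℝ) 1 (η k) := (hηs k).of_le (by norm_num)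
      exact (((continuous_dalembertian g h2).sub (continuous_innerDual_mvfderiv g hV1 h1)).abs.mul
        hWc).aestronglyMeasurable
    have h := tendsto_integral_of_dominated_convergence (fun y ↦ C * Real.exp (-V y)) hmeas (hfin.const_mul C)
      (fun k ↦ Eventually.of_forall fun y ↦ ?_) (Eventually.of_forall hLlim)
    · simpa using h
    · rw [Real.norm_eq_abs, abs_mul, abs_abs, abs_of_nonneg (Real.exp_pos _).le]
      exact mul_le_mul_of_nonneg_right (hηL k y) (Real.exp_pos _).le
  -- pass to the limit in the one-cut-off inequalities
  have Llhs := L1.sub L2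
  have Lrhs := (L3.const_mul (1 / (2 * K))).add ((L4.const_mul (C' * max |Real.log c| |Real.log C'| + G / c / (2 * K))).const_mul T)
  have hlim := le_of_tendsto_of_tendsto' Llhs Lrhs hk
  simpa using hlim

end Limit

/-- Registered helper `helper_entropyDissipation`: `H(0) − H(T) ≤ I(0)/(2K)` along a bounded positive solution of the
weighted heat equation with bounded gradient on a (non-compact) Riemannian manifold modelled on `ℝⁿ` with
`Ric + Hess V ≥ K g`, `K > 0`, given a cut-off family (`entropyDissipation_le`). [cite: CarrilloNi2009, §3 (p. 8)] -/
theorem helper_entropyDissipation : ∀ (n : ℕ) (M : Type*) [TopologicalSpace M] [T2Space M] [SecondCountableTopology M] [ChartedSpace (EuclideanSpace ℝ (Fin n)) M] [IsManifold (𝓡 n) ∞ M] [T3Space M] [MeasurableSpace M] [BorelSpace M] (g : PseudoRiemannianMetric (𝓡 n) ∞ (EuclideanSpace ℝ (Fin n)) (TangentSpace (𝓡 n) : M → Type _)) [g.HasLeviCivita] (V : M → ℝ) (K : ℝ), g.IsRiemannian → ContMDiff (𝓡 n) 𝓘(ℝ, ℝ) ∞ V → 0 < K → (∀ (x : M) (X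 : TangentSpace (𝓡 n) x), K * g.val x X X ≤ g.ricci x X X + g.hessian V x X X) → Integrable (fun x ↦ Real.exp (-V x)) g.riemVolume → ∀ (η : ℕ → M → ℝ) (C : ℝ), (∀ k, ContMDiff (𝓡 n) 𝓘(ℝ, ℝ) ∞ (η k)) → (∀ k, HasCompactSupport (η k)) → (∀ k x, 0 ≤ η k x ∧ η k x ≤ 1) → (∀ k x, η k x ≤ η (k + 1) x) → (∀ x, ∀ᶠ k in atTop, ∀ᶠ y in 𝓝 x, η k y = 1) → (∀ k x, |g.dalembertian (η k) x - g.innerDual x (mvfderiv (𝓡 n) V x).toLinearMap (mvfderiv (𝓡 n) (η k) x).toLinearMap| ≤ C) → ∀ (T : ℝ) (O : Set ℝ) (ρ : ℝ → M → ℝ), 0 < T → IsOpen O → Icc 0 T ⊆ O → ContMDiffOn ((𝓡 n).prod 𝓘(ℝ, ℝ)) 𝓘(ℝ, ℝ) ∞ (fun p : M × ℝ ↦ ρ p.2 p.1) (univ ×ˢ O) → (∀ s ∈ Icc 0 T, ∀ x, deriv (fun r ↦ ρ r x) s = g.dalembertian (ρ s) x - g.innerDual x (mvfderiv (𝓡 n)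 V x).toLinearMap (mvfderiv (𝓡 n) (ρ s) x).toLinearMap) → ∀ (c C' G : ℝ), 0 < c → (∀ s ∈ Icc 0 T, ∀ x, c ≤ ρ s x ∧ ρ s x ≤ C') → (∀ s ∈ Icc 0 T, ∀ x, g.gradSq (ρ s) x ≤ G) → (∫ x, ρ 0 x * Real.log (ρ 0 x) * Real.exp (-V x) ∂g.riemVolume) - (∫ x, ρ T x * Real.log (ρ T x) * Real.exp (-V x) ∂g.riemVolume) ≤ 1 / (2 * K) * ∫ x, g.gradSq (ρ 0) x / ρ 0 x * Real.exp (-V x) ∂g.riemVolume := by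
  intro n M _ _ _ _ _ _ _ _ g _ V K hg hV hK hRic hfin η C hηs hηc hη01 _hηmono hη1 hηL T O ρ hT hO hTO hρ heq
    c C' G hc hbd hgrad
  exact entropyDissipation_le hg hV hK hRic hfin hηs hηc hη01 hη1 hηL hT hO hTO hρ heq hc hbd hgrad

end Summit.SmoothPoincare4.SmoothPoincare4.Theorems.NoncompactShrinkerGapHeat

end
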